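import Summits.AtomisticToContinuum.Crystallization.Theorems.ChartedZeroExcessLayeredLatticeLiouvilleZZQ

/-!
# (B′.6) rider ZZZA — CONE PINS WITHOUT C-SIDE DIALS: the combinatorial FOUR transport and `pin_step_reg`

Lineage `stmt-AtomisticToContinuum-26636` (route ChartedPlanarOrder), lens-2 g81, FINDING «IC» (memo `g81/memo/FINDING-IC.md`, bus 2026-09-03 12:56Z).

WHY.  Tree ZZQ `pin_step` obtains the C-side second-shell relation `BarlowFour τ' (g x) (Θ (x + m'))` (its step `hA2`) from tree ZZF
`barlowFour_partner`, i.e. from a METRIC two-shell pattern of `C` at the partner (`hgood`) and the dial block `hϑ, haLo, hbond, hcov, hlo, hhi`.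
FINDING «IC» §F1: that block is jointly UNSATISFIABLE on admissible instances of (GL) (compressed clean crystals `a*·fcc`, `a* < 0.9367`): the
coverage inequality `1·(√2 + 1/16) + 2ε ≤ 3/2·aLo` leaves 1.6 % slack against ±6 % fuzz of declared scales at tolerance `1/16`.  This rider
supplies `hA2` with NO structure of `C` beyond its bond chart, for every site whose twelve link sites are REGISTERED (have `ε`-partners in the
chart domain) — under (GL)'s REG-out on the moat `(8, 43/2)` that is every site with `d(Ψ x, K) > 145/16` (FINDING «IC» §F3; the inner collar
`(8, 145/16]` is the residual obstruction §F4, not addressed here).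

CONTENT (all index-side except the two-point partner facts of tree ZZ):
* §1 KERNEL: for each of the sixteen letter contexts, every second-shell site `s ∈ shell2 (letters4 a b c d)` passes `fourB (letters4 a b c d) 0 s`
  (tree ZZG's `Bool` form of `BarlowFour`: `≠`, not adjacent, `≥ 4` common coded link sites) — one `decide` lemma per context (decide hygiene), and the
  sixteen assembled (`fourB_shell2`).
* §2 COMPLETENESS of `fourB` (`barlowFour_of_fourB`, converse of tree ZZG `fourB_of_barlowFour`: the passing coded link sites ARE four common
  neighbours, by `linkPt_injective`), UN-SHIFT (`barlowFour_add_of`, converse of ZZG `barlowFour_of_add`), and the absolute form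
  `barlowFour_shell2_abs : s ∈ shell2 (letters of τ at x) → BarlowFour τ x (x + s)` (letter locality ZZG `barlowFour_letters_congr`).
* §3 ★ `barlowFour_partner_reg` — REGISTRATION-ONLY TRANSPORT of `BarlowFour` through `ε`-partners: if `x, x'` and every common neighbour of
  `x, x'` are registered, `BarlowFour τ x x'` and the LOWER window bound `dist (Ψ x) (Ψ x') ≥ lo > 28/25 + 2ε` give `BarlowFour τ' (g x) (g x')`
  (common neighbours ↦ their partners: adjacent by tree ZZ `barlowAdj_partner`, distinct by `eq_of_partner_eq`; `g x ≠ g x'` and non-adjacency from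
  the lower bound alone).  No pattern of `C`, no `ϑ/aLo/aHi`, no coverage.
* §4 ★★ `pin_step_reg` — tree ZZQ `pin_step` VERBATIM with the binders `hgood hϑ haLo hbond hcov hlo hhi` REPLACED by the single registration binder
  `hreg : ∀ i, g (linkPt τ x i) ∈ D ∧ dist (Ψ (linkPt τ x i)) (Φ (g (linkPt τ x i))) ≤ ε` (the twelve link sites of `x` are registered); `hlo'`
  (`28/25 + 2ε < 9/10(√2 − 1/16)`, a consequence of `ε ≤ 1/40`) stays.  Same conclusion `g x = Θ x`.

0 sorry; no `native_decide`; no new real-side estimate.  Rider ZZZB (B′.6b) puts tree ZZT `pin_extension` on top of `pin_step_reg`; the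
edition of ZZU `slabIso_package` dropping `hgoodC` and the dial block from the junction waits for the inner-collar ruling (FINDING «IC» §F4).
-/

open scoped RealInnerProductSpace
open Literature.Geometry.DiscreteGeometry (intVec sqNormInt dotInt IsTwoShellGoodSet)

namespace Summit.AtomisticToContinuum.Crystallization.Theorems.ChartedZeroExcessLayeredLatticeLiouville

open Summit.AtomisticToContinuum.Crystallization.Theorems.ChartedPlanarOrderRigidityDoor (E3)

/-! ## ZZZA-1  Kernel: second-shell sites pass `fourB` (one lemma per letter context) -/

/-- letter context `true true true true`: every second-shell site passes `fourB` against the origin. [this file, g81; `decide`] -/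
theorem fourB_shell2_tttt : ∀ s ∈ shell2 (letters4 true true true true), fourB (letters4 true true true true) 0 s = true := by
  decide

/-- letter context `true true true false`: every second-shell site passes `fourB` against the origin. [this file, g81; `decide`] -/
theorem fourB_shell2_tttf : ∀ s ∈ shell2 (letters4 true true true false), fourB (letters4 true true true false) 0 s = true := by
  decide

/-- letter context `true true false true`: every second-shell site passes `fourB` against the origin. [this file, g81; `decide`] -/
theorem fourB_shell2_ttft : ∀ s ∈ shell2 (letters4 true true false true), fourB (letters4 true true false true) 0 s = true := by
  decide

/-- letter context `true true false false`: every second-shell site passes `fourB` against the origin. [this file, g81; `decide`] -/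
theorem fourB_shell2_ttff : ∀ s ∈ shell2 (letters4 true true false false), fourB (letters4 true true false false) 0 s = true := by
  decide

/-- letter context `true false true true`: every second-shell site passes `fourB` against the origin. [this file, g81; `decide`] -/
theorem fourB_shell2_tftt : ∀ s ∈ shell2 (letters4 true false true true), fourB (letters4 true false true true) 0 s = true := by
  decide

/-- letter context `true false true false`: every second-shell site passes `fourB` against the origin. [this file, g81; `decide`] -/
theorem fourB_shell2_tftf : ∀ s ∈ shell2 (letters4 true false true false), fourB (letters4 true false true false) 0 s = true := by
  decide

/-- letter context `true false false true`: every second-shell site passes `fourB` against the origin. [this file, g81; `decide`] -/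
theorem fourB_shell2_tfft : ∀ s ∈ shell2 (letters4 true false false true), fourB (letters4 true false false true) 0 s = true := by
  decide

/-- letter context `true false false false`: every second-shell site passes `fourB` against the origin. [this file, g81; `decide`] -/
theorem fourB_shell2_tfff : ∀ s ∈ shell2 (letters4 true false false false), fourB (letters4 true false false false) 0 s = true := by
  decide

/-- letter context `false true true true`: every second-shell site passes `fourB` against the origin. [this file, g81; `decide`] -/
theorem fourB_shell2_fttt : ∀ s ∈ shell2 (letters4 false true true true), fourB (letters4 false true true true) 0 s = true := by
  decide

/-- letter context `false true true false`: every second-shell site passes `fourB` against the origin. [this file, g81; `decide`] -/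
theorem fourB_shell2_fttf : ∀ s ∈ shell2 (letters4 false true true false), fourB (letters4 false true true false) 0 s = true := by
  decide

/-- letter context `false true false true`: every second-shell site passes `fourB` against the origin. [this file, g81; `decide`] -/
theorem fourB_shell2_ftft : ∀ s ∈ shell2 (letters4 false true false true), fourB (letters4 false true false true) 0 s = true := by
  decide

/-- letter context `false true false false`: every second-shell site passes `fourB` against the origin. [this file, g81; `decide`] -/
theorem fourB_shell2_ftff : ∀ s ∈ shell2 (letters4 false true false false), fourB (letters4 false true false false) 0 s = true := by
  decide

/-- letter context `false false true true`: every second-shell site passes `fourB` against the origin. [this file, g81; `decide`] -/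
theorem fourB_shell2_fftt : ∀ s ∈ shell2 (letters4 false false true true), fourB (letters4 false false true true) 0 s = true := by
  decide

/-- letter context `false false true false`: every second-shell site passes `fourB` against the origin. [this file, g81; `decide`] -/
theorem fourB_shell2_fftf : ∀ s ∈ shell2 (letters4 false false true false), fourB (letters4 false false true false) 0 s = true := by
  decide

/-- letter context `false false false true`: every second-shell site passes `fourB` against the origin. [this file, g81; `decide`] -/
theorem fourB_shell2_ffft : ∀ s ∈ shell2 (letters4 false false false true), fourB (letters4 false false false true) 0 s = true := by
  decide

/-- letter context `false false false false`: every second-shell site passes `fourB` against the origin. [this file, g81; `decide`] -/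
theorem fourB_shell2_ffff : ∀ s ∈ shell2 (letters4 false false false false), fourB (letters4 false false false false) 0 s = true := by
  decide

/-- ★ KERNEL FACT assembled over the sixteen letter contexts. [this file, g81] -/
theorem fourB_shell2 : ∀ a b c d : Bool, ∀ s ∈ shell2 (letters4 a b c d), fourB (letters4 a b c d) 0 s = true := by
  intro a b c d
  cases a <;> cases b <;> cases c <;> cases d
  exacts [fourB_shell2_ffff, fourB_shell2_ffft, fourB_shell2_fftf, fourB_shell2_fftt, fourB_shell2_ftff, fourB_shell2_ftft,
    fourB_shell2_fttf, fourB_shell2_fttt, fourB_shell2_tfff, fourB_shell2_tfft, fourB_shell2_tftf, fourB_shell2_tftt,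
    fourB_shell2_ttff, fourB_shell2_ttft, fourB_shell2_tttf, fourB_shell2_tttt]

/-! ## ZZZA-2  Completeness of `fourB`, un-shift, absolute form -/

/-- ★ COMPLETENESS of `fourB` (converse of tree ZZG `fourB_of_barlowFour`): the passing coded link sites of `m` are `≥ 4` common neighbours.
[this file, g81] -/
theorem barlowFour_of_fourB {ℓ : ℤ → Bool} {x m : ℤ × ℤ × ℤ} (h : fourB ℓ x m = true) : BarlowFour ℓ x m := by
  classical
  simp only [fourB, Bool.and_eq_true, decide_eq_true_eq, Bool.not_eq_true'] at h
  obtain ⟨⟨hne, hnadj⟩, hcount⟩ := h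
  refine ⟨hne, fun h' => ?_, (Finset.univ.filter fun i : Fin 12 => barlowAdjB ℓ x (linkPt ℓ m i) = true).image (linkPt ℓ m), ?_, ?_⟩
  · have h1 := (barlowAdjB_iff ℓ x m).2 h'
    rw [hnadj] at h1
    exact Bool.false_ne_true h1
  · rw [Finset.card_image_of_injective _ (linkPt_injective ℓ m)]
    exact hcount
  · intro z hz
    obtain ⟨i, hi, rfl⟩ := Finset.mem_image.1 hz
    simp only [Finset.mem_filter, Finset.mem_univ, true_and] at hi
    exact ⟨(barlowAdjB_iff ℓ x _).1 hi, barlowAdj_symm (barlowAdj_symm (barlowAdj_linkPt ℓ m i))⟩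

/-- UN-SHIFT (converse of tree ZZG `barlowFour_of_add`). [this file, g81] -/
theorem barlowFour_add_of {τ : ℤ → Bool} {v y y' : ℤ × ℤ × ℤ} (h : BarlowFour (fun m => τ (v.1 + m)) y y') :
    BarlowFour τ (v + y) (v + y') := by
  obtain ⟨hne, hnadj, T, hT, hTz⟩ := h
  refine ⟨fun e => hne (add_left_cancel e), fun h' => hnadj ((barlowAdj_add_iff τ v y y').1 h'), T.image (fun z => v + z), ?_, ?_⟩
  · rwa [Finset.card_image_of_injective _ (add_right_injective v)]
  · intro z hz
    obtain ⟨z₀, hz₀, rfl⟩ := Finset.mem_image.1 hz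
    obtain ⟨h1, h2⟩ := hTz z₀ hz₀
    exact ⟨(barlowAdj_add_iff τ v y z₀).2 h1, (barlowAdj_add_iff τ v y' z₀).2 h2⟩

/-- ★ ABSOLUTE FORM: a second-shell site of the letter context of `τ` at `x` is `BarlowFour`-related to `x` in the chart lattice. [this file, g81] -/
theorem barlowFour_shell2_abs (τ : ℤ → Bool) (x : ℤ × ℤ × ℤ) {s : ℤ × ℤ × ℤ}
    (hs : s ∈ shell2 (letters4 (τ (x.1 - 2)) (τ (x.1 - 1)) (τ x.1) (τ (x.1 + 1)))) : BarlowFour τ x (x + s) := by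
  have h1 := barlowFour_of_fourB (fourB_shell2 _ _ _ _ s hs)
  have hs1 := shell2_fst _ _ _ _ s hs
  have h2 : BarlowFour (fun m => τ (x.1 + m)) 0 s :=
    barlowFour_letters_congr (ℓ := letters4 (τ (x.1 - 2)) (τ (x.1 - 1)) (τ x.1) (τ (x.1 + 1))) (ℓ' := fun m => τ (x.1 + m))
      (fun m hm1 hm2 => (letters4_shift τ x m hm1 hm2).symm) (by simp) (by simp) hs1.1 hs1.2 h1
  have h3 := barlowFour_add_of h2
  rwa [add_zero] at h3

/-! ## ZZZA-3  ★ Registration-only transport of `BarlowFour` through partners -/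

/-- ★ **REGISTRATION-ONLY FOUR TRANSPORT** (FINDING «IC» §F3).  S-chart `Ψ, τ` (global), C-chart `Φ, τ'` on `D`, partner map `g`; `x`, `x'` and
every COMMON NEIGHBOUR of `x, x'` registered (`ε`-partners in `D`); `BarlowFour τ x x'`; and the S-distance of `x, x'` at least `lo > 28/25 + 2ε`.
Then `BarlowFour τ' (g x) (g x')`.  No pattern of `C`, no scale dials, no coverage radius. [this file, g81] -/
theorem barlowFour_partner_reg {S C : Set E3} {D : Set (ℤ × ℤ × ℤ)} {Ψ Φ : ℤ × ℤ × ℤ → E3} {τ τ' : ℤ → Bool}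
    {g : ℤ × ℤ × ℤ → ℤ × ℤ × ℤ} {ε δS βS lo : ℝ} (hΨ : IsBarlowBondChart S Set.univ Ψ τ) (hΦ : IsBarlowBondChart C D Φ τ')
    (hsepS : ∀ p ∈ S, ∀ p' ∈ S, p ≠ p' → δS ≤ dist p p') (hε : 2 * ε < δS)
    (hgapS : ∀ p ∈ S, ∀ p' ∈ S, IsBond p p' → dist p p' ≤ βS) (hβS : βS + 2 * ε ≤ 28 / 25)
    {x x' : ℤ × ℤ × ℤ} (hxD : g x ∈ D) (hxd : dist (Ψ x) (Φ (g x)) ≤ ε) (hx'D : g x' ∈ D) (hx'd : dist (Ψ x') (Φ (g x')) ≤ ε)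
    (hnb : ∀ z, BarlowAdj τ x z → BarlowAdj τ x' z → g z ∈ D ∧ dist (Ψ z) (Φ (g z)) ≤ ε)
    (hfour : BarlowFour τ x x') (hwlo : lo ≤ dist (Ψ x) (Ψ x')) (hlo' : 28 / 25 + 2 * ε < lo) :
    BarlowFour τ' (g x) (g x') := by
  classical
  obtain ⟨-, -, T, hT, hTz⟩ := hfour
  have hup := dist_ge_of_partners hxd hx'd
  have hdist : 28 / 25 < dist (Φ (g x)) (Φ (g x')) := by linarith
  refine ⟨fun e => ?_, fun h' => ?_, T.image g, ?_, ?_⟩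
  · rw [e, dist_self] at hdist
    linarith
  · have hb : IsBond (Φ (g x)) (Φ (g x')) := (hΦ.2.2 _ hxD _ hx'D).2 h'
    exact absurd hb.2 (not_le.2 hdist)
  · rw [Finset.card_image_of_injOn]
    · exact hT
    · intro z hz z' hz' e
      exact eq_of_partner_eq hΨ hsepS hε (hnb z (hTz z hz).1 (hTz z hz).2).2 (hnb z' (hTz z' hz').1 (hTz z' hz').2).2 e
  · intro w hw
    obtain ⟨z, hz, rfl⟩ := Finset.mem_image.1 hw
    obtain ⟨h1, h2⟩ := hTz z hz
    obtain ⟨hzD, hzd⟩ := hnb z h1 h2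
    exact ⟨barlowAdj_partner hΨ hΦ hsepS hε hgapS hβS hxD hzD hxd hzd h1,
      barlowAdj_partner hΨ hΦ hsepS hε hgapS hβS hx'D hzD hx'd hzd h2⟩

/-! ## ZZZA-4  ★★ The pin step without C-side dials -/

/-- ★★ THE PIN STEP, REGISTRATION FORM (FINDING «IC» §F3).  Tree ZZQ `pin_step` verbatim, except that the C-side second-shell relation (`hA2`) is
obtained by `barlowFour_shell2_abs` + `barlowFour_partner_reg` from the REGISTRATION OF THE TWELVE LINK SITES of `x` (`hreg`) instead of a metric
two-shell pattern of `C` at the partner: the binders `hgood hϑ haLo hbond hcov hlo hhi` of `pin_step` are gone; `hlo'` stays.  Valid wherever the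
link of `x` is registered — under REG-out on the moat `(8, 43/2)`, for `d(Ψ x, K) > 145/16`. [this file, g81] -/
theorem pin_step_reg {S C : Set E3} {D P N : Set (ℤ × ℤ × ℤ)} {Ψ Φ : ℤ × ℤ × ℤ → E3} {τ τ' : ℤ → Bool}
    {g Θ : ℤ × ℤ × ℤ → ℤ × ℤ × ℤ} {ε δS βS : ℝ} {x₀ : E3} {x : ℤ × ℤ × ℤ}
    (hΨ : IsBarlowBondChart S Set.univ Ψ τ) (hclean : ∀ p ∈ S, IsTwoShellGoodSet (1 / 16) (9 / 10) 1 S p)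
    (hsepS : ∀ p ∈ S, ∀ p' ∈ S, p ≠ p' → δS ≤ dist p p') (hε : 2 * ε < δS)
    (hgapS : ∀ p ∈ S, ∀ p' ∈ S, IsBond p p' → dist p p' ≤ βS) (hβS : βS + 2 * ε ≤ 28 / 25)
    (hΦ : IsBarlowBondChart C D Φ τ') (hxD : g x ∈ D) (hxd : dist (Ψ x) (Φ (g x)) ≤ ε)
    (hreg : ∀ i, g (linkPt τ x i) ∈ D ∧ dist (Ψ (linkPt τ x i)) (Φ (g (linkPt τ x i))) ≤ ε)
    (hlo' : 28 / 25 + 2 * ε < 9 / 10 * (Real.sqrt 2 - 1 / 16))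
    (hP : ∀ y ∈ P, g y = Θ y ∧ g y ∈ D ∧ dist (Ψ y) (Φ (g y)) ≤ ε)
    (hiso : ∀ y y' : ℤ × ℤ × ℤ, y ∈ N → (BarlowAdj τ y y' ↔ BarlowAdj τ' (Θ y) (Θ y')))
    (hsurj : ∀ y ∈ N, ∀ v : ℤ × ℤ × ℤ, BarlowAdj τ' (Θ y) v → ∃ y', Θ y' = v)
    (hN1 : ∀ i, linkPt τ x i ∈ N) (hN2 : ∀ i j, linkPt τ (linkPt τ x i) j ∈ N)
    (hN3 : ∀ i j k, linkPt τ (linkPt τ (linkPt τ x i) j) k ∈ N)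
    (hw : Ψ x ≠ x₀)
    (hcone : ∀ y : ℤ × ℤ × ℤ, 1 / 2 * (‖Ψ y - Ψ x‖ * ‖Ψ x - x₀‖) ≤ ⟪Ψ y - Ψ x, Ψ x - x₀⟫ →
      0 < dist (Ψ y) (Ψ x) → dist (Ψ y) (Ψ x) ≤ 43 / 20 → y ∈ P) :
    g x = Θ x := by
  have hw' : Ψ x - x₀ ≠ 0 := sub_ne_zero.2 hw
  obtain ⟨a, F, w', cs, ha, ha1, hn, hFw, hcell, hCAP, hF1, hF2, hσ1, hσ2⟩ :=
    cell_at_site hΨ (Set.mem_univ x) (fun _ => Set.mem_univ _) (fun _ _ => Set.mem_univ _) hclean hw'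
  -- (1) first-shell members: link sites of `x`, processed, inside `N`
  have hP1 : ∀ m ∈ cellSigma1 (letters4 (τ (x.1 - 2)) (τ (x.1 - 1)) (τ x.1) (τ (x.1 + 1))) cs,
      BarlowAdj τ x (x + m) ∧ x + m ∈ P ∧ x + m ∈ N := by
    intro m hm
    obtain ⟨i, hi, hcone', hdist⟩ := hσ1 m hm
    have hadj : BarlowAdj τ x (x + m) := by rw [hi]; exact barlowAdj_linkPt τ x i
    have hpos : 0 < dist (Ψ (x + m)) (Ψ x) := by
      rw [dist_comm]; exact ((hΨ.2.2 x (Set.mem_univ _) (x + m) (Set.mem_univ _)).2 hadj).1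
    exact ⟨hadj, hcone _ hcone' hpos (by linarith), by rw [hi]; exact hN1 i⟩
  -- (2) second-shell members: orthogonal two-step sites of `x`, processed, inside `N`, in the S-distance window
  have hP2 : ∀ m' ∈ cellSigma2 (letters4 (τ (x.1 - 2)) (τ (x.1 - 1)) (τ x.1) (τ (x.1 + 1))) cs,
      x + m' ∈ P ∧ x + m' ∈ N ∧ (∃ i j : Fin 12, x + m' = linkPt τ (linkPt τ x i) j) ∧
        9 / 10 * (Real.sqrt 2 - 1 / 16) ≤ dist (Ψ x) (Ψ (x + m')) ∧ dist (Ψ x) (Ψ (x + m')) ≤ 1 * (Real.sqrt 2 + 1 / 16) := by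
    intro m' hm'
    obtain ⟨-, -, -, hcone', hdist⟩ := hσ2 m' hm'
    obtain ⟨i, j, horth, hij, -⟩ := shell2_cover (τ (x.1 - 2)) (τ (x.1 - 1)) (τ x.1) (τ (x.1 + 1)) m' (mem_cellSigma2.1 hm').1
    have he : x + m' = linkPt τ (linkPt τ x i) j := by rw [linkPt_linkPt_eq_add_letters4, hij]
    have hpl := hF2 i j horth
    rw [← he] at hpl
    obtain ⟨hwlo, hwhi⟩ := dist_window_of_secondShell (aLo := 9 / 10) (aHi := 1) (θ := 1 / 16) (by norm_num) ha ha1 (by norm_num)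
      (by norm_num) (norm_iotaPt_add_of_orth horth) hpl
    have hpos : 0 < dist (Ψ (x + m')) (Ψ x) := by
      have h2 := sqrt_two_bounds.1
      rw [dist_comm]; linarith
    exact ⟨hcone _ hcone' hpos (by linarith), by rw [he]; exact hN2 i j, ⟨i, j, he⟩, hwlo, hwhi⟩
  -- (3) partners of the members in the C-lattice
  have hA1 : ∀ m ∈ cellSigma1 (letters4 (τ (x.1 - 2)) (τ (x.1 - 1)) (τ x.1) (τ (x.1 + 1))) cs, BarlowAdj τ' (g x) (Θ (x + m)) := by
    intro m hm
    obtain ⟨hadj, hyP, -⟩ := hP1 m hm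
    obtain ⟨hg, hyD, hyd⟩ := hP _ hyP
    rw [← hg]
    exact barlowAdj_partner hΨ hΦ hsepS hε hgapS hβS hxD hyD hxd hyd hadj
  have hA2 : ∀ m' ∈ cellSigma2 (letters4 (τ (x.1 - 2)) (τ (x.1 - 1)) (τ x.1) (τ (x.1 + 1))) cs, BarlowFour τ' (g x) (Θ (x + m')) := by
    intro m' hm'
    obtain ⟨hyP, -, -, hwlo, -⟩ := hP2 m' hm'
    obtain ⟨hg, hyD, hyd⟩ := hP _ hyP
    rw [← hg]
    have hfour : BarlowFour τ x (x + m') := barlowFour_shell2_abs τ x (mem_cellSigma2.1 hm').1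
    refine barlowFour_partner_reg hΨ hΦ hsepS hε hgapS hβS hxD hxd hyD hyd (fun z hz _ => ?_) hfour hwlo hlo'
    obtain ⟨k, hk⟩ := exists_linkPt_of_barlowAdj hz
    rw [hk]
    exact hreg k
  -- (4) the Θ-preimage `xs` of `g x`, through a first-shell member
  obtain ⟨m₀, hm₀⟩ := List.exists_mem_of_ne_nil _ (cellSigma1_ne_nil hcell)
  obtain ⟨-, -, hm₀N⟩ := hP1 m₀ hm₀
  obtain ⟨xs, hxs⟩ := hsurj (x + m₀) hm₀N (g x) (barlowAdj_symm (hA1 m₀ hm₀))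
  -- (5) the member relations pulled back to the S-lattice at `xs`
  have hB1 : ∀ m ∈ cellSigma1 (letters4 (τ (x.1 - 2)) (τ (x.1 - 1)) (τ x.1) (τ (x.1 + 1))) cs, BarlowAdj τ xs (x + m) := by
    intro m hm
    obtain ⟨-, -, hmN⟩ := hP1 m hm
    have h := hA1 m hm
    rw [← hxs] at h
    exact barlowAdj_symm ((hiso (x + m) xs hmN).2 (barlowAdj_symm h))
  have hB2 : ∀ m' ∈ cellSigma2 (letters4 (τ (x.1 - 2)) (τ (x.1 - 1)) (τ x.1) (τ (x.1 + 1))) cs, BarlowFour τ xs (x + m') := by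
    intro m' hm'
    obtain ⟨-, hyN, ⟨i, j, he⟩, -, -⟩ := hP2 m' hm'
    obtain ⟨hne, hnadj, T, hT4, hT⟩ := hA2 m' hm'
    rw [← hxs] at hne hnadj hT
    refine ⟨fun h => hne (by rw [h]), fun h => hnadj (barlowAdj_symm ((hiso (x + m') xs hyN).1 (barlowAdj_symm h))), ?_⟩
    have hpre : ∀ v ∈ T, ∃ v' : ℤ × ℤ × ℤ, Θ v' = v := fun v hv => hsurj (x + m') hyN v (hT v hv).2
    choose pre hpre using hpre
    classical
    have hinj : Function.Injective (fun v : {v // v ∈ T} => pre v.1 v.2) := by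
      intro v v' h
      apply Subtype.ext
      have h' := congrArg Θ h
      simp only at h'
      rwa [hpre v.1 v.2, hpre v'.1 v'.2] at h'
    refine ⟨T.attach.image (fun v => pre v.1 v.2), ?_, ?_⟩
    · rw [Finset.card_image_of_injective _ hinj, Finset.card_attach]
      exact hT4
    · intro v' hv'
      obtain ⟨v, -, rfl⟩ := Finset.mem_image.1 hv'
      obtain ⟨h1, h2⟩ := hT v.1 v.2
      rw [← hpre v.1 v.2] at h1 h2
      have h2' : BarlowAdj τ (x + m') (pre v.1 v.2) := (hiso (x + m') _ hyN).2 h2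
      obtain ⟨k, hk⟩ := exists_linkPt_of_barlowAdj h2'
      have hvN : pre v.1 v.2 ∈ N := by rw [hk, he]; exact hN3 i j k
      exact ⟨barlowAdj_symm ((hiso _ xs hvN).2 (barlowAdj_symm h1)), h2'⟩
  -- (6) the kernel-checked cell test: `xs = x`, or `xs − x` is an allowed competitor — which the processed cone excludes
  rcases pin_sound_abs (v := x) (A := cellAllowed (letters4 (τ (x.1 - 2)) (τ (x.1 - 1)) (τ x.1) (τ (x.1 + 1))) cs) hcell
      (fun m hm => shell1_fst _ m (mem_cellSigma1.1 hm).1) (fun m hm => shell2_fst _ _ _ _ m (mem_cellSigma2.1 hm).1) hB1 hB2 with hEq | hmem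
  · rw [hEq] at hxs
    exact hxs.symm
  · obtain ⟨hcone', hlo27, hhi17⟩ :=
      competitor_cone hΨ (fun _ => Set.mem_univ _) (fun _ _ => Set.mem_univ _) hclean ha hn hFw hF1 rfl hCAP hmem
    rw [add_sub_cancel] at hcone' hlo27 hhi17
    obtain ⟨hg, -, hd⟩ := hP xs (hcone xs hcone' (by linarith) (by linarith))
    have hxx : xs = x := eq_of_partner_eq hΨ hsepS hε hd hxd (by rw [hg, hxs])
    rw [hxx] at hg
    exact hg

end Summit.AtomisticToContinuum.Crystallization.Theorems.ChartedZeroExcessLayeredLatticeLiouville
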